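import Summits.ResolutionOfSingularities.ResolutionOfSingularities.Theorems.FrobeniusLadderFInjectiveMacaulayficationLocalFullificationFibreAdmGe4Split
import Summits.ResolutionOfSingularities.ResolutionOfSingularities.Theorems.FrobeniusLadderFInjectiveMacaulayficationFTemkinClosedPointsAdm
import Summits.ResolutionOfSingularities.ResolutionOfSingularities.Theorems.FrobeniusLadderFInjectiveMacaulayficationFInjectiveMacaulayficationDimFour
import Summits.ResolutionOfSingularities.ResolutionOfSingularities.Theorems.FrobeniusLadderFInjectiveMacaulayficationTerminationModClosedPoints
import Summits.ResolutionOfSingularities.ResolutionOfSingularities.Theorems.FrobeniusLadderFInjectiveMacaulayficationDimLe4Reduced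
import HarnessLib

/-!
# THE DIM-FOUR SLICE OF THE CRUX: on varieties of dimension ≤ 4, `FInjectiveMacaulayfication` ⟸ {CP 2019 Thm 1.1, R–G 081R, CP 2019 Prop 4.4,
# Česnavičius 2021 Thm 5.3} ∧ the F-HALF AT d = 4 ALONE (crux `FInjectiveMacaulayfication` stmt-ResolutionOfSingularities-15315, chain w45a;
# res-L1-w45a-plan-1 NAMED OBJECT 02:05:01Z «DIM-FOUR SLICE»; seat res-L1-w45a-stub-3 g7)

[OURS · L1 W4.5a] Support file (`--supports stmt-ResolutionOfSingularities-15315 --as helper`); NOT a statement of any manuscript; def-free; CONDITIONAL on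
the three printed theorems of the threefold package BY NAME, on ONE printed theorem taken as the spelled-out `Prop`-binder `hM` (= the candidate
Literature text `CesnaviciusBlowupMacaulayfication` of res-L1-w45a-stub-2's FACT-REQUEST, verbatim as in `LocalMacaulayficationOfFact` p589894 /
`OfLocalDoorAdm` §3 p594133 — admission pending, CZ3), and on the chain's CANDIDATE F-half AT d = 4 ONLY, `hF4` = the body of
`LocalFullificationFibreAdmGe4Split.LocalFInjectivizationFibreAdmGe4` (p591179) with `d` fixed to `4` («a Cohen–Macaulay integral 4-dimensional
admissible local blow-up scheme, regular off its closed fibre, is FULL-ified by one fibre-supported blowing up»). AI-written (weaker than expert review).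

REPORT (plan-1's question «is `OfLocalDoorAdm` dimension-local enough to restrict?»): its STATEMENT is not (the (LR_adm)/(LF_adm) binders are global
∀-d statements and `OfFullBlowupGe4` wants a full-model supplier in every dimension ≥ 4), but its INTERNALS are, and on 4-folds the (LR_adm) input is
not needed at all: THEOREM A(4) (`TerminationModClosedPoints`, Cossart–Piltant below dimension 4 — no local-resolution hypothesis) + res-L1-w45a-stub-2's
dimension-free engine `FTemkinClosedPointsAdm.full_model_of_regularOffFinite_of_localAdm` (whose `hloc` is per variety, at closed singular points) + a
POINTWISE CM/F split (§1, = stub-2's `localFullificationFibreAdmGe4_of_split` proof re-cut for ONE point) + `LocalMacaulayficationOfFact.exists_cmCentre_of_fact hM`.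
* §1 `exists_fullCentre_of_cmHalf_of_fHalf_at` — pointwise split at a singular point `x`: CM-centres for the fibre-regular local blow-ups at `x` ∧ the
  F-half for the admissible fibre-regular CM local blow-ups at `x` ⇒ FULL centres for the admissible fibre-regular local blow-ups at `x`;
* §2 `exists_isBlowup_full_dimFour_of_fact_of_F4 … (h4 : topologicalKrullDim X = 4)` — a blow-up model FULL at every point;
* §3 **`fInjectiveMacaulayfication_dimLe4_of_fact_of_F4 (hG h081R hP) (hM) (hF4) : «the route decl's ∀-text + one binder topologicalKrullDim X ≤ 4»`**
  (dimension ≤ 3: Cossart–Piltant outright, `FInjectiveMacaulayficationDimFour.fiModel_integral_of_dim_le_three`; reduced ↦ integral components as in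
  `DimLe4Reduced`). With res-L1-w45a-idea-1's DP4-r1 census (positive, currency = `hF4`'s instances at I = ⊤) this is the kernel form of «where W4.5a
  stands on fourfolds».
[folklore assembly; cite: Temkin2008, Prop. 2.3.4] [cite: CossartPiltant2019, Thm. 1.1 (i)(ii); Prop. 4.4] [cite: Cesnavicius2021, Thm. 5.3]
[cite: StacksProject, Tag 080B; Tag 085U]
-/

-- single-problem summit: the doubled namespace component is forced
set_option linter.dupNamespace false

noncomputable section

namespace Summit.ResolutionOfSingularities.ResolutionOfSingularities.Theorems.FInjectiveMacaulayfication.FInjectiveMacaulayficationDimFourSlice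

open CategoryTheory CategoryTheory.Limits AlgebraicGeometry TopologicalSpace IsLocalRing
open Literature.AlgebraicGeometry.Resolution
open Summit.ResolutionOfSingularities.ResolutionOfSingularities.Theorems.FInjectiveMacaulayfication
open SliceableCentre

/-! ## §1 The pointwise CM/F split at one singular point -/

-- adapted from res-L1-w45a-stub-2's `LocalFullificationFibreAdmGe4Split.localFullificationFibreAdmGe4_of_split` (p591179): same proof, hypotheses at ONE point
set_option maxHeartbeats 800000 in
-- two blow-up existence calls, one 080B composite, one uniqueness transport
/-- **Pointwise CM/F split.** At a singular point `x` of an integral variety `X`: if every fibre-regular local blow-up `S′ → Spec 𝒪_{X,x}` (along `I ≠ ⊥`)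
has a fibre-supported centre all of whose blowings up have domain Cohen–Macaulay stalks (CM-half), and every ADMISSIBLE fibre-regular Cohen–Macaulay
local blow-up has a fibre-supported centre all of whose blowings up are FULL (F-half), then every admissible fibre-regular local blow-up at `x` has a
fibre-supported centre all of whose blowings up are FULL. [folklore assembly; cite: StacksProject, Tag 080B; Tag 085U] -/
theorem exists_fullCentre_of_cmHalf_of_fHalf_at
    (p : ℕ) {k : Type} [Field k] {X : Scheme.{0}} (f : X ⟶ Spec (.of k)) [LocallyOfFiniteType f] [IsIntegral X]
    (x : X) (hxs : x ∉ Scheme.regularLocus X)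
    (hCM : ∀ (S' : Scheme.{0}) (g : S' ⟶ Spec (X.presheaf.stalk x)) (I : (Spec (X.presheaf.stalk x)).IdealSheafData),
      I ≠ ⊥ → IsBlowup g I → (∀ s : S', g.base s ≠ closedPoint (X.presheaf.stalk x) → s ∈ Scheme.regularLocus S') →
      ∃ 𝓚 : S'.IdealSheafData, 𝓚 ≠ ⊥ ∧ (∀ s ∈ (𝓚.support : Set S'), g.base s = closedPoint (X.presheaf.stalk x)) ∧
        ∀ (S'' : Scheme.{0}) (π : S'' ⟶ S'), IsBlowup π 𝓚 → ∀ s : S'', IsDomain (S''.presheaf.stalk s) ∧ CMCl (S''.presheaf.stalk s))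
    (hF : ∀ (S' : Scheme.{0}) (g : S' ⟶ Spec (X.presheaf.stalk x)) (I : (Spec (X.presheaf.stalk x)).IdealSheafData),
      I ≠ ⊥ → (I.support : Set (Spec (X.presheaf.stalk x))) ⊆ (Scheme.regularLocus (Spec (X.presheaf.stalk x)))ᶜ → IsBlowup g I →
      (∀ s : S', g.base s ≠ closedPoint (X.presheaf.stalk x) → s ∈ Scheme.regularLocus S') →
      (∀ s : S', CMCl (S'.presheaf.stalk s)) →
      ∃ 𝓚 : S'.IdealSheafData, 𝓚 ≠ ⊥ ∧ (∀ s ∈ (𝓚.support : Set S'), g.base s = closedPoint (X.presheaf.stalk x)) ∧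
        ∀ (S'' : Scheme.{0}) (π : S'' ⟶ S'), IsBlowup π 𝓚 → ∀ s : S'', FullCl p (S''.presheaf.stalk s))
    (S' : Scheme.{0}) (g : S' ⟶ Spec (X.presheaf.stalk x)) (I : (Spec (X.presheaf.stalk x)).IdealSheafData)
    (hI : I ≠ ⊥) (hIadm : (I.support : Set (Spec (X.presheaf.stalk x))) ⊆ (Scheme.regularLocus (Spec (X.presheaf.stalk x)))ᶜ)
    (hg : IsBlowup g I) (hreg : ∀ s : S', g.base s ≠ closedPoint (X.presheaf.stalk x) → s ∈ Scheme.regularLocus S') :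
    ∃ 𝓚 : S'.IdealSheafData, 𝓚 ≠ ⊥ ∧ (∀ s ∈ (𝓚.support : Set S'), g.base s = closedPoint (X.presheaf.stalk x)) ∧
      ∀ (S'' : Scheme.{0}) (π : S'' ⟶ S'), IsBlowup π 𝓚 → ∀ s : S'', FullCl p (S''.presheaf.stalk s) := by
  classical
  haveI : IsLocallyNoetherian X := LocallyOfFiniteType.isLocallyNoetherian f
  haveI : IsIntegral S' := hg.isIntegral hI
  haveI : IsProper g := hg.isProper
  haveI : IsLocallyNoetherian S' := LocallyOfFiniteType.isLocallyNoetherian g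
  haveI : CompactSpace S' := QuasiCompact.compactSpace_of_compactSpace g
  haveI : IsNoetherian S' := {}
  -- Step 1: Macaulayfy `S'` along a fibre-supported `𝓚₁`
  obtain ⟨𝓚₁, h𝓚₁ne, h𝓚₁fib, h𝓚₁cm⟩ := hCM S' g I hI hg hreg
  obtain ⟨S₁, π₁, hπ₁⟩ := exists_isBlowup S' 𝓚₁
  haveI : IsIntegral S₁ := hπ₁.isIntegral h𝓚₁ne
  haveI : IsProper π₁ := hπ₁.isProper
  haveI : IsLocallyNoetherian S₁ := LocallyOfFiniteType.isLocallyNoetherian π₁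
  haveI : CompactSpace S₁ := QuasiCompact.compactSpace_of_compactSpace π₁
  haveI : IsNoetherian S₁ := {}
  -- `S₁ → Spec 𝒪_{X,x}` is again a blowing up, along a non-zero ADMISSIBLE centre (080B; the closed point is singular since `x ∉ Reg X`)
  obtain ⟨I₁, hI₁, hI₁T⟩ := hg.exists_isBlowup_comp_supported g I π₁ 𝓚₁
    ((I.support : Set (Spec (X.presheaf.stalk x))) ∪ {closedPoint (X.presheaf.stalk x)}) Set.subset_union_left hπ₁
    (fun s hs => Or.inr (h𝓚₁fib s hs))
  have hI₁ne : I₁ ≠ ⊥ := RegularBlowupModelDim2.ne_bot_of_isBlowup hI₁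
  have hI₁adm : (I₁.support : Set (Spec (X.presheaf.stalk x))) ⊆ (Scheme.regularLocus (Spec (X.presheaf.stalk x)))ᶜ := by
    refine hI₁T.trans (Set.union_subset hIadm ?_)
    rintro _ rfl hreg0
    apply hxs
    haveI : Flat (X.fromSpecStalk x) := flat_fromSpecStalk X x
    have := (mem_regularLocus_iff_of_flat_of_isPreimmersion (X.fromSpecStalk x) (closedPoint (X.presheaf.stalk x))).mp hreg0
    rwa [Scheme.fromSpecStalk_closedPoint] at this
  have hcomp : ∀ s : S₁, (π₁ ≫ g).base s = g.base (π₁.base s) := fun s => by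
    rw [Scheme.Hom.comp_apply]
  -- `S₁` is regular off its closed fibre and Cohen–Macaulay everywhere
  have hreg₁ : ∀ s : S₁, (π₁ ≫ g).base s ≠ closedPoint (X.presheaf.stalk x) → s ∈ Scheme.regularLocus S₁ := by
    intro s hs
    rw [hcomp] at hs
    have hs' : π₁.base s ∉ (𝓚₁.support : Set S') := fun h => hs (h𝓚₁fib _ h)
    haveI := hπ₁.isIso_compl
    exact (mem_regularLocus_iff_of_isIso_morphismRestrict π₁ ⟨(𝓚₁.support : Set S')ᶜ, 𝓚₁.support.isClosed.isOpen_compl⟩ s hs').mpr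
      (hreg _ hs)
  have hcm₁ : ∀ s : S₁, CMCl (S₁.presheaf.stalk s) := fun s => (h𝓚₁cm S₁ π₁ hπ₁ s).2
  -- Step 2: F-injectivise `S₁` along a fibre-supported `𝓚₂`
  obtain ⟨𝓚₂, h𝓚₂ne, h𝓚₂fib, h𝓚₂full⟩ := hF S₁ (π₁ ≫ g) I₁ hI₁ne hI₁adm hI₁ hreg₁ hcm₁
  obtain ⟨S₂, π₂, hπ₂⟩ := exists_isBlowup S₁ 𝓚₂
  haveI : IsIntegral S₂ := hπ₂.isIntegral h𝓚₂ne
  -- Step 3: `S₂ → S₁ → S'` is ONE blowing up of `S'` along a fibre-supported `𝓚 ≠ ⊥` (080B)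
  obtain ⟨𝓚, h𝓚, h𝓚T⟩ := hπ₁.exists_isBlowup_comp_supported π₁ 𝓚₁ π₂ 𝓚₂
    {s : S' | g.base s = closedPoint (X.presheaf.stalk x)} (fun s hs => h𝓚₁fib s hs) hπ₂
    (fun s hs => by
      have h := h𝓚₂fib s hs
      rw [hcomp] at h
      exact h)
  have h𝓚ne : 𝓚 ≠ ⊥ := RegularBlowupModelDim2.ne_bot_of_isBlowup h𝓚
  refine ⟨𝓚, h𝓚ne, fun s hs => h𝓚T hs, fun S'' π hπ s => ?_⟩
  -- Step 4: uniqueness of blowing up + stalk transport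
  obtain ⟨e, -, -⟩ := hπ.unique h𝓚
  exact FTemkinClosedPoints.fullCl_of_isIso_stalkMap' p e.hom s (h𝓚₂full S₂ π₂ hπ₂ (e.hom s))

/-! ## §2 The FULL blow-up model of a fourfold from the fact and the F-half at d = 4 -/

/-- **A FULL blow-up model of every integral separated finite-type FOURFOLD**, modulo {CP 1.1, 081R, CP 4.4} ∧ [Česnavičius 5.3 as typed] ∧ the
F-half at `d = 4`. THEOREM A(4) supplies a model regular off finitely many closed points; the dimension-free F-Temkin engine finishes at the closed
singular points with the pointwise split (§1). [OURS · conditional-result] [cite: Temkin2008, Prop. 2.3.4] [cite: CossartPiltant2019, Thm. 1.1; Prop. 4.4]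
[cite: Cesnavicius2021, Thm. 5.3] -/
theorem exists_isBlowup_full_dimFour_of_fact_of_F4
    (hG : CossartPiltant2019General.{0}) (h081R : Stacks081R.{0}) (hP : CossartPiltant2019Principalization.{0})
    (hM : ∀ (Y : Scheme.{0}) [IsIntegral Y] [IsNoetherian Y], Scheme.IsExcellent Y →
      ∃ Z : Y.IdealSheafData,
        (∀ y : Y, y ∈ (Z.support : Set Y) →
          ¬ (∀ d : ℕ, ringKrullDim (Y.presheaf.stalk y) = d →
              ∀ s : Fin d → Y.presheaf.stalk y, (Ideal.span (Set.range s)).radical.IsMaximal →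
                RingTheory.Sequence.IsWeaklyRegular (Y.presheaf.stalk y) (List.ofFn s))) ∧
        ∀ (Y' : Scheme.{0}) (π : Y' ⟶ Y), IsBlowup π Z →
          ∀ y' : Y', ∀ d : ℕ, ringKrullDim (Y'.presheaf.stalk y') = d →
            ∀ s : Fin d → Y'.presheaf.stalk y', (Ideal.span (Set.range s)).radical.IsMaximal →
              RingTheory.Sequence.IsWeaklyRegular (Y'.presheaf.stalk y') (List.ofFn s))
    (hF4 : ∀ (p : ℕ), p.Prime → ∀ (k : Type) [Field k] [CharP k p]
    (X : Scheme.{0}) (f : X ⟶ Spec (.of k)),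
      IsSeparated f → LocallyOfFiniteType f → QuasiCompact f → IsIntegral X →
      ∀ x : X, IsClosed ({x} : Set X) → x ∉ Scheme.regularLocus X → ringKrullDim (X.presheaf.stalk x) = 4 →
      ∀ (S' : Scheme.{0}) (g : S' ⟶ Spec (X.presheaf.stalk x)) (I : (Spec (X.presheaf.stalk x)).IdealSheafData),
        I ≠ ⊥ → (I.support : Set (Spec (X.presheaf.stalk x))) ⊆ (Scheme.regularLocus (Spec (X.presheaf.stalk x)))ᶜ → IsBlowup g I →
        (∀ s : S', g.base s ≠ closedPoint (X.presheaf.stalk x) → s ∈ Scheme.regularLocus S') →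
        (∀ s : S', CMCl (S'.presheaf.stalk s)) →
        ∃ 𝓚 : S'.IdealSheafData, 𝓚 ≠ ⊥ ∧ (∀ s ∈ (𝓚.support : Set S'), g.base s = closedPoint (X.presheaf.stalk x)) ∧
          ∀ (S'' : Scheme.{0}) (π : S'' ⟶ S'), IsBlowup π 𝓚 →
            ∀ s : S'', FullCl p (S''.presheaf.stalk s))
    (p : ℕ) (hp : p.Prime) (k : Type) [Field k] [CharP k p] (X : Scheme.{0}) (f₀ : X ⟶ Spec (.of k))
    [IsSeparated f₀] [LocallyOfFiniteType f₀] [QuasiCompact f₀] [IsIntegral X] (h4 : topologicalKrullDim X = 4) :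
    ∃ (X'' : Scheme.{0}) (f'' : X'' ⟶ X) (J'' : X.IdealSheafData), IsBlowup f'' J'' ∧ J'' ≠ ⊥ ∧
      (J''.support : Set X) ⊆ (Scheme.regularLocus X)ᶜ ∧ ∀ x'' : X'', FullCl p (X''.presheaf.stalk x'') := by
  classical
  obtain ⟨X', f, J, hf, -, hJ, F, hF, hFcl, hreg⟩ :=
    TerminationModClosedPoints.exists_isBlowup_regular_off_finite_closedPoints hG h081R hP f₀ h4
  refine FTemkinClosedPointsAdm.full_model_of_regularOffFinite_of_localAdm p hp k X f₀ ?_ X' f J hf hJ hF.toFinset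
    (fun b hb => hFcl b (hF.mem_toFinset.mp hb)) (fun x' hx' => hreg x' fun h => hx' (hF.mem_toFinset.mpr h))
  intro b hbcl hbs S' g I hI hIadm hg hregS
  have hb4 : ringKrullDim (X.presheaf.stalk b) = 4 := FTemkinClosedPoints.ringKrullDim_stalk_eq_of_isClosed f₀ h4 b hbcl
  exact exists_fullCentre_of_cmHalf_of_fHalf_at p f₀ b hbs
    (fun S' g I hI hg hregS => LocalMacaulayficationOfFact.exists_cmCentre_of_fact hM p hp f₀ b S' g I hI hg hregS)
    (fun S' g I hI hIadm hg hregS hcm =>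
      hF4 p hp k X f₀ inferInstance inferInstance inferInstance inferInstance b hbcl hbs hb4 S' g I hI hIadm hg hregS hcm)
    S' g I hI hIadm hg hregS

/-! ## §3 The dim ≤ 4 slice of the crux -/

/-- **Integral form, dimension ≤ 4**: a proper birational integral model FULL at every point (dimension ≤ 3: Cossart–Piltant outright).
[OURS · conditional-result] [cite: CossartPiltant2019, Thm. 1.1; Prop. 4.4] [cite: Temkin2008, Prop. 2.3.4] [cite: Cesnavicius2021, Thm. 5.3] -/
theorem fiModel_integral_dimLe4_of_fact_of_F4
    (hG : CossartPiltant2019General.{0}) (h081R : Stacks081R.{0}) (hP : CossartPiltant2019Principalization.{0})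
    (hM : ∀ (Y : Scheme.{0}) [IsIntegral Y] [IsNoetherian Y], Scheme.IsExcellent Y →
      ∃ Z : Y.IdealSheafData,
        (∀ y : Y, y ∈ (Z.support : Set Y) →
          ¬ (∀ d : ℕ, ringKrullDim (Y.presheaf.stalk y) = d →
              ∀ s : Fin d → Y.presheaf.stalk y, (Ideal.span (Set.range s)).radical.IsMaximal →
                RingTheory.Sequence.IsWeaklyRegular (Y.presheaf.stalk y) (List.ofFn s))) ∧
        ∀ (Y' : Scheme.{0}) (π : Y' ⟶ Y), IsBlowup π Z →
          ∀ y' : Y', ∀ d : ℕ, ringKrullDim (Y'.presheaf.stalk y') = d →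
            ∀ s : Fin d → Y'.presheaf.stalk y', (Ideal.span (Set.range s)).radical.IsMaximal →
              RingTheory.Sequence.IsWeaklyRegular (Y'.presheaf.stalk y') (List.ofFn s))
    (hF4 : ∀ (p : ℕ), p.Prime → ∀ (k : Type) [Field k] [CharP k p]
    (X : Scheme.{0}) (f : X ⟶ Spec (.of k)),
      IsSeparated f → LocallyOfFiniteType f → QuasiCompact f → IsIntegral X →
      ∀ x : X, IsClosed ({x} : Set X) → x ∉ Scheme.regularLocus X → ringKrullDim (X.presheaf.stalk x) = 4 →
      ∀ (S' : Scheme.{0}) (g : S' ⟶ Spec (X.presheaf.stalk x)) (I : (Spec (X.presheaf.stalk x)).IdealSheafData),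
        I ≠ ⊥ → (I.support : Set (Spec (X.presheaf.stalk x))) ⊆ (Scheme.regularLocus (Spec (X.presheaf.stalk x)))ᶜ → IsBlowup g I →
        (∀ s : S', g.base s ≠ closedPoint (X.presheaf.stalk x) → s ∈ Scheme.regularLocus S') →
        (∀ s : S', CMCl (S'.presheaf.stalk s)) →
        ∃ 𝓚 : S'.IdealSheafData, 𝓚 ≠ ⊥ ∧ (∀ s ∈ (𝓚.support : Set S'), g.base s = closedPoint (X.presheaf.stalk x)) ∧
          ∀ (S'' : Scheme.{0}) (π : S'' ⟶ S'), IsBlowup π 𝓚 →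
            ∀ s : S'', FullCl p (S''.presheaf.stalk s))
    (p : ℕ) [hp : Fact p.Prime] (k : Type) [Field k] [CharP k p] (X : Scheme.{0}) (f : X ⟶ Spec (.of k))
    [IsSeparated f] [LocallyOfFiniteType f] [QuasiCompact f] [IsIntegral X] (h4 : topologicalKrullDim X ≤ 4) :
    ∃ (X' : Scheme.{0}) (π : X' ⟶ X), IsProper π ∧ IsBirational π ∧ IsIntegral X' ∧ ∀ x : X', FullCl p (X'.presheaf.stalk x) := by
  by_cases h3 : topologicalKrullDim X ≤ 3
  · exact FInjectiveMacaulayficationDimFour.fiModel_integral_of_dim_le_three hG p k X f h3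
  · have h4' : topologicalKrullDim X = 4 := by
      have h := h4
      induction hD : topologicalKrullDim X using WithBot.recBotCoe with
      | bot => rw [hD] at h3; exact absurd bot_le h3
      | coe a =>
        rw [hD] at h h3
        induction a using ENat.recTopCoe with
        | top => exact absurd (WithBot.coe_le_coe.mp h) (by simp)
        | coe n =>
          have hn : n ≤ 4 := by exact_mod_cast (WithBot.coe_le_coe.mp h)
          have hn' : ¬ n ≤ 3 := fun hle =>
            h3 (WithBot.coe_le_coe.mpr (by exact_mod_cast hle : (n : ℕ∞) ≤ (3 : ℕ∞)))
          have : n = 4 := by omega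
          subst this
          rfl
    haveI : IsLocallyNoetherian X := LocallyOfFiniteType.isLocallyNoetherian f
    obtain ⟨X'', f'', J'', hf'', hJ'', -, hfull⟩ := exists_isBlowup_full_dimFour_of_fact_of_F4 hG h081R hP hM hF4 p hp.out k X f h4'
    haveI : IsIntegral X'' := hf''.isIntegral hJ''
    exact ⟨X'', f'', hf''.isProper, hf''.isBirational' hJ'', inferInstance, hfull⟩

/-- **The crux's conclusion for a given reduced `X` of dimension ≤ 4** (component gluing as in `DimLe4Reduced`). [OURS · conditional-result]
[cite: CossartPiltant2019, Thm. 1.1; Prop. 4.4; proof of Prop. 4.6 Step 1] [cite: Cesnavicius2021, Thm. 5.3] -/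
theorem exists_fiModel_dimLe4_of_fact_of_F4
    (hG : CossartPiltant2019General.{0}) (h081R : Stacks081R.{0}) (hP : CossartPiltant2019Principalization.{0})
    (hM : ∀ (Y : Scheme.{0}) [IsIntegral Y] [IsNoetherian Y], Scheme.IsExcellent Y →
      ∃ Z : Y.IdealSheafData,
        (∀ y : Y, y ∈ (Z.support : Set Y) →
          ¬ (∀ d : ℕ, ringKrullDim (Y.presheaf.stalk y) = d →
              ∀ s : Fin d → Y.presheaf.stalk y, (Ideal.span (Set.range s)).radical.IsMaximal →
                RingTheory.Sequence.IsWeaklyRegular (Y.presheaf.stalk y) (List.ofFn s))) ∧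
        ∀ (Y' : Scheme.{0}) (π : Y' ⟶ Y), IsBlowup π Z →
          ∀ y' : Y', ∀ d : ℕ, ringKrullDim (Y'.presheaf.stalk y') = d →
            ∀ s : Fin d → Y'.presheaf.stalk y', (Ideal.span (Set.range s)).radical.IsMaximal →
              RingTheory.Sequence.IsWeaklyRegular (Y'.presheaf.stalk y') (List.ofFn s))
    (hF4 : ∀ (p : ℕ), p.Prime → ∀ (k : Type) [Field k] [CharP k p]
    (X : Scheme.{0}) (f : X ⟶ Spec (.of k)),
      IsSeparated f → LocallyOfFiniteType f → QuasiCompact f → IsIntegral X →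
      ∀ x : X, IsClosed ({x} : Set X) → x ∉ Scheme.regularLocus X → ringKrullDim (X.presheaf.stalk x) = 4 →
      ∀ (S' : Scheme.{0}) (g : S' ⟶ Spec (X.presheaf.stalk x)) (I : (Spec (X.presheaf.stalk x)).IdealSheafData),
        I ≠ ⊥ → (I.support : Set (Spec (X.presheaf.stalk x))) ⊆ (Scheme.regularLocus (Spec (X.presheaf.stalk x)))ᶜ → IsBlowup g I →
        (∀ s : S', g.base s ≠ closedPoint (X.presheaf.stalk x) → s ∈ Scheme.regularLocus S') →
        (∀ s : S', CMCl (S'.presheaf.stalk s)) →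
        ∃ 𝓚 : S'.IdealSheafData, 𝓚 ≠ ⊥ ∧ (∀ s ∈ (𝓚.support : Set S'), g.base s = closedPoint (X.presheaf.stalk x)) ∧
          ∀ (S'' : Scheme.{0}) (π : S'' ⟶ S'), IsBlowup π 𝓚 →
            ∀ s : S'', FullCl p (S''.presheaf.stalk s))
    (p : ℕ) [Fact p.Prime] (k : Type) [Field k] [CharP k p] (X : Scheme.{0}) (f : X ⟶ Spec (.of k))
    [IsSeparated f] [LocallyOfFiniteType f] [QuasiCompact f] [IsReduced X] (h4 : topologicalKrullDim X ≤ 4) :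
    ∃ (X' : Scheme.{0}) (π : X' ⟶ X), IsProper π ∧ IsBirational π ∧ ∀ x : X',
      IsDomain (X'.presheaf.stalk x) ∧ ∀ d : ℕ, ringKrullDim (X'.presheaf.stalk x) = d →
        ∀ s : Fin d → X'.presheaf.stalk x, (Ideal.span (Set.range s)).radical.IsMaximal →
          RingTheory.Sequence.IsWeaklyRegular (X'.presheaf.stalk x) (List.ofFn s) ∧
          ∀ y : X'.presheaf.stalk x, (∃ e : ℕ, y ^ p ^ e ∈ Ideal.span
            ((fun z : X'.presheaf.stalk x => z ^ p ^ e) ''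
              (Ideal.span (Set.range s) : Set (X'.presheaf.stalk x)))) →
            y ∈ Ideal.span (Set.range s) := by
  refine exists_model_of_forall_closeds
    (fun Y : Scheme.{0} => ∀ y : Y, IsDomain (Y.presheaf.stalk y) ∧
      ∀ d : ℕ, ringKrullDim (Y.presheaf.stalk y) = d →
        ∀ s : Fin d → Y.presheaf.stalk y, (Ideal.span (Set.range s)).radical.IsMaximal →
          RingTheory.Sequence.IsWeaklyRegular (Y.presheaf.stalk y) (List.ofFn s) ∧
          ∀ w : Y.presheaf.stalk y, (∃ e : ℕ, w ^ p ^ e ∈ Ideal.span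
            ((fun z : Y.presheaf.stalk y => z ^ p ^ e) ''
              (Ideal.span (Set.range s) : Set (Y.presheaf.stalk y)))) →
            w ∈ Ideal.span (Set.range s))
    (fun Y hY y => (hY.false y).elim) (fun U V hU hV => fiClause_coprod p hU hV) X f fun Z hZ => ?_
  haveI := hZ
  have hdimZ : topologicalKrullDim (Scheme.IdealSheafData.vanishingIdeal Z).subscheme ≤ 4 :=
    (DimLe4Reduced.topologicalKrullDim_subscheme_vanishingIdeal_le Z).trans h4
  obtain ⟨X', π, hprop, hbir, -, hfi⟩ :=
    fiModel_integral_dimLe4_of_fact_of_F4 hG h081R hP hM hF4 p k _ ((Scheme.IdealSheafData.vanishingIdeal Z).subschemeι ≫ f) hdimZ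
  exact ⟨X', π, hprop, hbir, hfi⟩

/-- **★ THE DIM ≤ 4 SLICE OF THE CRUX ⟸ {CP 1.1, R–G 081R, CP 4.4, Česnavičius 5.3 (as typed)} ∧ F-HALF(4).** The ∀-text of
`Theses.FrobeniusLadder.FInjectiveMacaulayfication` VERBATIM with the single extra binder `topologicalKrullDim X ≤ 4`. [OURS · conditional-result]
[cite: CossartPiltant2019, Thm. 1.1; Prop. 4.4] [cite: Temkin2008, Prop. 2.3.4] [cite: Cesnavicius2021, Thm. 5.3] -/
theorem fInjectiveMacaulayfication_dimLe4_of_fact_of_F4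
    (hG : CossartPiltant2019General.{0}) (h081R : Stacks081R.{0}) (hP : CossartPiltant2019Principalization.{0})
    (hM : ∀ (Y : Scheme.{0}) [IsIntegral Y] [IsNoetherian Y], Scheme.IsExcellent Y →
      ∃ Z : Y.IdealSheafData,
        (∀ y : Y, y ∈ (Z.support : Set Y) →
          ¬ (∀ d : ℕ, ringKrullDim (Y.presheaf.stalk y) = d →
              ∀ s : Fin d → Y.presheaf.stalk y, (Ideal.span (Set.range s)).radical.IsMaximal →
                RingTheory.Sequence.IsWeaklyRegular (Y.presheaf.stalk y) (List.ofFn s))) ∧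
        ∀ (Y' : Scheme.{0}) (π : Y' ⟶ Y), IsBlowup π Z →
          ∀ y' : Y', ∀ d : ℕ, ringKrullDim (Y'.presheaf.stalk y') = d →
            ∀ s : Fin d → Y'.presheaf.stalk y', (Ideal.span (Set.range s)).radical.IsMaximal →
              RingTheory.Sequence.IsWeaklyRegular (Y'.presheaf.stalk y') (List.ofFn s))
    (hF4 : ∀ (p : ℕ), p.Prime → ∀ (k : Type) [Field k] [CharP k p]
    (X : Scheme.{0}) (f : X ⟶ Spec (.of k)),
      IsSeparated f → LocallyOfFiniteType f → QuasiCompact f → IsIntegral X →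
      ∀ x : X, IsClosed ({x} : Set X) → x ∉ Scheme.regularLocus X → ringKrullDim (X.presheaf.stalk x) = 4 →
      ∀ (S' : Scheme.{0}) (g : S' ⟶ Spec (X.presheaf.stalk x)) (I : (Spec (X.presheaf.stalk x)).IdealSheafData),
        I ≠ ⊥ → (I.support : Set (Spec (X.presheaf.stalk x))) ⊆ (Scheme.regularLocus (Spec (X.presheaf.stalk x)))ᶜ → IsBlowup g I →
        (∀ s : S', g.base s ≠ closedPoint (X.presheaf.stalk x) → s ∈ Scheme.regularLocus S') →
        (∀ s : S', CMCl (S'.presheaf.stalk s)) →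
        ∃ 𝓚 : S'.IdealSheafData, 𝓚 ≠ ⊥ ∧ (∀ s ∈ (𝓚.support : Set S'), g.base s = closedPoint (X.presheaf.stalk x)) ∧
          ∀ (S'' : Scheme.{0}) (π : S'' ⟶ S'), IsBlowup π 𝓚 →
            ∀ s : S'', FullCl p (S''.presheaf.stalk s)) :
    ∀ p : ℕ, p.Prime → ∀ (k : Type) [Field k] [CharP k p] (X : Scheme.{0}) (f : X ⟶ Spec (.of k)),
      IsSeparated f → LocallyOfFiniteType f → QuasiCompact f → IsReduced X → topologicalKrullDim X ≤ 4 →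
      ∃ (X' : Scheme.{0}) (π : X' ⟶ X), IsProper π ∧ IsBirational π ∧ ∀ x : X',
        IsDomain (X'.presheaf.stalk x) ∧ ∀ d : ℕ, ringKrullDim (X'.presheaf.stalk x) = d →
          ∀ s : Fin d → X'.presheaf.stalk x, (Ideal.span (Set.range s)).radical.IsMaximal →
            RingTheory.Sequence.IsWeaklyRegular (X'.presheaf.stalk x) (List.ofFn s) ∧
            ∀ y : X'.presheaf.stalk x, (∃ e : ℕ, y ^ p ^ e ∈ Ideal.span
              ((fun z : X'.presheaf.stalk x => z ^ p ^ e) ''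
                (Ideal.span (Set.range s) : Set (X'.presheaf.stalk x)))) →
              y ∈ Ideal.span (Set.range s) := by
  intro p hp k _ _ X f hsep hft hqc hred h4
  haveI : Fact p.Prime := ⟨hp⟩
  haveI := hsep
  haveI := hft
  haveI := hqc
  haveI := hred
  exact exists_fiModel_dimLe4_of_fact_of_F4 hG h081R hP hM hF4 p k X f h4

end Summit.ResolutionOfSingularities.ResolutionOfSingularities.Theorems.FInjectiveMacaulayfication.FInjectiveMacaulayficationDimFourSlice

end
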